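import Literature.AlgebraicTopology.SingularHomology.StdSimplexHorn
import Literature.AlgebraicTopology.SingularHomology.HurewiczSimplexClass
import Mathlib.Topology.Order.Lattice
import HarnessLib

/-!
# The homotopy addition theorem, step 1: reduction to the free face of a filled horn

Topic `Literature/AlgebraicTopology/SingularHomology`. Towards a PROOF of the named fact
`homotopyAddition` (`HomotopyAddition.lean`: E. H. Spanier, *Algebraic Topology* (1981), Ch. 7 §5
Prop. 3, the homotopy addition theorem `∑ (-1)ⁱ [σ⁽ⁱ⁾] = 0` for a singular `(n+1)`-simplex `σ` with
`(n-1)`-skeleton at the base point) for the device `cls := simplexClass` of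
`HurewiczSimplexClass.lean`, i.e. of the nullity `HomotopyAdditionData.prod_cls_face_zpow_eq_one`
for `simplexClass` ((i) `simplexClass_surjective` and (ii) `simplexClass_const` being proved there).
This file performs the first,
purely convex-geometric reduction, everything PROVED (`[folklore]`; compare G. W. Whitehead,
*Elements of Homotopy Theory* (1978), Ch. IV §6, where the theorem is likewise reduced to the
additivity of maps supported on the cells of a subdivided cell):

* `hornFace g hg : C(Δⁿ, X)` — the **free face** `M(g) = (hornFill g) ∘ δ_last` of the horn
  `Λ = Λ_{last}ⁿ⁺¹` filled with prescribed faces `gᵢ : (Δⁿ, ∂Δⁿ) → (X, x₀)`, `i ≠ last`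
  (`StdSimplexHorn.lean`); it sends `∂Δⁿ` to `x₀` (`hornFace_apply_of_mem_stdBoundary`);
* `simplexClass_comp_stdFace_last` — **reduction**: for `τ : Δⁿ⁺¹ → X` sending every point with
  two vanishing coordinates to `x₀`, the last face `τ ∘ δ_last` and the free face
  `M(τ ∘ δ₀, …, τ ∘ δₙ)` have the same class in `πₙ(X, x₀)`: `τ ≃ τ ∘ r` rel `Λ` along the segments
  to the horn retraction `r` (convexity), and `τ = hornGlue (τ ∘ δ·)` on `Λ`;
* the **regions and charts of the free face**: `Δⁿ = ⋃ᵢ minCone i`, `minCone i = {z | zᵢ = min z}`,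
  the composite `hornRho = r ∘ δ_last : Δⁿ → Λ` (`hornRho_apply_castSucc`, `hornRho_apply_last`:
  `z ↦ (z - (min z)·𝟙, (n+1) min z)`), and on `minCone i` the free face is the prescribed face
  `gᵢ` read through the chart `hornChart i = faceRetr i ∘ hornRho` (affine on `minCone i`; shown to
  be a bijection onto `Δⁿ` where needed in the sequel) (`hornFace_apply_of_mem_minCone`,
  `hornChart_apply_of_mem_minCone`).

The remaining steps (additivity over the regions, the sign `(-1)ⁿ⁺ⁱ` of the chart of region `i`)
are in the sequel files.

## References

* E. H. Spanier, *Algebraic Topology*, Springer 1981, Ch. 7 §5, Prop. 3 and (d) p. 397. [Spanier1981]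
* G. W. Whitehead, *Elements of Homotopy Theory*, GTM 61, Springer 1978, Ch. IV §6.
* A. Hatcher, *Algebraic Topology*, CUP 2002, §4.1 p. 340 (sums in `πₙ`). [HatcherAT2002]
-/

noncomputable section

open Set Function
open scoped unitInterval Topology Topology.Homotopy

universe u

namespace Literature.AlgebraicTopology.SingularHomology

variable {X : Type u} [TopologicalSpace X] {x₀ : X} {n : ℕ}

/-! ### Points with two vanishing coordinates -/

/-- A point of `Δᵏ⁺²` with two distinct vanishing coordinates lies in the `k`-skeleton. [folklore] -/
lemma mem_stdSkel_of_two_zero {k : ℕ} {t : StdSimplex (k + 2)} {i l : Fin (k + 3)} (hil : i ≠ l)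
    (hi : (t : Fin (k + 3) → ℝ) i = 0) (hl : (t : Fin (k + 3) → ℝ) l = 0) : t ∈ stdSkel (k + 2) k := by
  rw [mem_stdSkel_iff]
  have hsub : StdSimplex.nzCoords t ⊆ (Finset.univ.erase i).erase l := fun j hj => by
    rw [StdSimplex.mem_nzCoords] at hj
    rw [Finset.mem_erase, Finset.mem_erase]
    exact ⟨fun h => hj (h ▸ hl), fun h => hj (h ▸ hi), Finset.mem_univ _⟩
  have hcard : ((Finset.univ.erase i).erase l).card = k + 1 := by
    rw [Finset.card_erase_of_mem (Finset.mem_erase.2 ⟨hil.symm, Finset.mem_univ _⟩),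
      Finset.card_erase_of_mem (Finset.mem_univ _), Finset.card_univ, Fintype.card_fin]
    omega
  exact (Finset.card_le_card hsub).trans hcard.le

/-- The last coface of a boundary point of `Δⁿ` has two vanishing coordinates: the last one and the
(shifted) vanishing coordinate of the point. [folklore] -/
lemma exists_two_zero_stdFace_last {z : StdSimplex n} (hz : z ∈ stdBoundary n) :
    ∃ i l : Fin (n + 2), i ≠ l ∧ (stdFace (Fin.last (n + 1)) z : Fin (n + 2) → ℝ) i = 0 ∧
      (stdFace (Fin.last (n + 1)) z : Fin (n + 2) → ℝ) l = 0 := by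
  obtain ⟨j, hj⟩ := hz
  refine ⟨Fin.last (n + 1), j.castSucc, (Fin.castSucc_lt_last j).ne', stdFace_apply_self _ z, ?_⟩
  rw [← Fin.succAbove_last_apply, stdFace_apply_succAbove]
  exact hj

/-- A coface `δᵢ z` of a boundary point `z ∈ ∂Δⁿ` has two vanishing coordinates. [folklore] -/
lemma exists_two_zero_stdFace (i : Fin (n + 2)) {z : StdSimplex n} (hz : z ∈ stdBoundary n) :
    ∃ a l : Fin (n + 2), a ≠ l ∧ (stdFace i z : Fin (n + 2) → ℝ) a = 0 ∧
      (stdFace i z : Fin (n + 2) → ℝ) l = 0 := by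
  obtain ⟨j, hj⟩ := hz
  refine ⟨i, i.succAbove j, (Fin.succAbove_ne i j).symm, stdFace_apply_self i z, ?_⟩
  rw [stdFace_apply_succAbove]
  exact hj

section HornFace

variable (τ : C(StdSimplex (n + 1), X))

/-- The hypothesis of the homotopy addition theorem: `τ` is `x₀` at every point with two distinct
vanishing coordinates (i.e. on the codimension-two skeleton of `Δⁿ⁺¹`). [folklore] -/
def KillsTwoZero (x₀ : X) (τ : C(StdSimplex (n + 1), X)) : Prop :=
  ∀ (t : StdSimplex (n + 1)) (i l : Fin (n + 2)), i ≠ l → (t : Fin (n + 2) → ℝ) i = 0 →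
    (t : Fin (n + 2) → ℝ) l = 0 → τ t = x₀

variable {τ}

/-- The faces of such a `τ` send `∂Δⁿ` to `x₀`. [folklore] -/
lemma KillsTwoZero.comp_stdFace (hτ : KillsTwoZero x₀ τ) (i : Fin (n + 2)) :
    ∀ z ∈ stdBoundary n, (τ.comp (stdFace i)) z = x₀ := fun z hz => by
  obtain ⟨a, l, hal, ha, hl⟩ := exists_two_zero_stdFace i hz
  exact hτ _ a l hal ha hl

/-- The family of faces of such a `τ` is admissible horn data for any free index. [folklore] -/
lemma KillsTwoZero.faces_boundary (hτ : KillsTwoZero x₀ τ) (j : Fin (n + 2)) :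
    ∀ l, l ≠ j → ∀ z ∈ stdBoundary n, (fun i => τ.comp (stdFace i)) l z = x₀ :=
  fun l _ z hz => hτ.comp_stdFace l z hz

/-- A map `Δᵐ⁺³ → X` constant on the `(m+1)`-skeleton kills every point with two vanishing
coordinates (the form of the hypothesis of `HomotopyAdditionData.prod_cls_face_zpow_eq_one`,
`HomotopyAddition.lean`). [folklore] -/
lemma killsTwoZero_of_stdSkel {m : ℕ} {τ : C(StdSimplex (m + 3), X)}
    (hτ : ∀ t ∈ stdSkel (m + 3) (m + 1), τ t = x₀) : KillsTwoZero x₀ τ :=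
  fun _ _ _ hil hi hl => hτ _ (mem_stdSkel_of_two_zero hil hi hl)

end HornFace

/-! ### The free face of a filled horn -/

section FreeFace

variable (g : Fin (n + 2) → C(StdSimplex n, X))
  (hg : ∀ l, l ≠ Fin.last (n + 1) → ∀ z ∈ stdBoundary n, g l z = x₀)

/-- **The free face `M(g)` of the horn `Λ_last` filled with the faces `gᵢ`, `i ≠ last`**:
`(hornFill g) ∘ δ_last : Δⁿ → X`. [folklore] -/
def hornFace : C(StdSimplex n, X) :=
  (hornFill (Fin.last (n + 1)) g hg).comp (stdFace (Fin.last (n + 1)))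

/-- Unfolding: `M(g) z = hornGlue g (r (δ_last z))`. [folklore] -/
lemma hornFace_apply (z : StdSimplex n) :
    hornFace g hg z = hornGlue (Fin.last (n + 1)) g (hornRetr (Fin.last (n + 1)) (stdFace (Fin.last (n + 1)) z)) :=
  rfl

/-- **The free face sends `∂Δⁿ` to `x₀`** (its boundary lies in the codimension-two skeleton of
`Δⁿ⁺¹`, where the filling is `x₀`). [folklore] -/
theorem hornFace_apply_of_mem_stdBoundary {z : StdSimplex n} (hz : z ∈ stdBoundary n) :
    hornFace g hg z = x₀ := by
  obtain ⟨i, l, hil, hi, hl⟩ := exists_two_zero_stdFace_last hz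
  exact hornFill_apply_of_two_zero g hg hil hi hl

end FreeFace

/-! ### Reduction of the last face to the free face -/

section Reduction

/-- Convex combination `(1 - s) a + s b` of two points of the standard simplex (the two-point case
of `StdSimplex.affComb`, `Subdivision.lean`, kept as a local convenience to avoid `Fin 2`
bookkeeping in homotopies). [folklore] -/
def StdSimplex.segm {q : ℕ} (s : I) (a b : StdSimplex q) : StdSimplex q :=
  ⟨(1 - (s : ℝ)) • (a : Fin (q + 1) → ℝ) + (s : ℝ) • (b : Fin (q + 1) → ℝ),
    (convex_stdSimplex ℝ (Fin (q + 1))) a.2 b.2 (by linarith [s.2.2]) s.2.1 (by ring)⟩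

/-- The convex combination is jointly continuous. [folklore] -/
lemma StdSimplex.continuous_segm {q : ℕ} :
    Continuous fun p : I × StdSimplex q × StdSimplex q => StdSimplex.segm p.1 p.2.1 p.2.2 := by
  refine Continuous.subtype_mk ?_ _
  exact ((continuous_const.sub (continuous_subtype_val.comp continuous_fst)).smul
    (continuous_subtype_val.comp (continuous_fst.comp continuous_snd))).add
    ((continuous_subtype_val.comp continuous_fst).smul
      (continuous_subtype_val.comp (continuous_snd.comp continuous_snd)))

/-- Coordinates of the convex combination. [folklore] -/
lemma StdSimplex.segm_apply {q : ℕ} (s : I) (a b : StdSimplex q) (i : Fin (q + 1)) :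
    (StdSimplex.segm s a b : Fin (q + 1) → ℝ) i =
      (1 - (s : ℝ)) * (a : Fin (q + 1) → ℝ) i + (s : ℝ) * (b : Fin (q + 1) → ℝ) i := rfl

/-- At `s = 0` the combination is `a`. [folklore] -/
@[simp]
lemma StdSimplex.segm_zero {q : ℕ} (a b : StdSimplex q) : StdSimplex.segm 0 a b = a := by
  apply Subtype.ext; funext i
  change (1 - ((0 : I) : ℝ)) * (a : Fin (q + 1) → ℝ) i + ((0 : I) : ℝ) * (b : Fin (q + 1) → ℝ) i =
    (a : Fin (q + 1) → ℝ) i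
  simp

/-- At `s = 1` the combination is `b`. [folklore] -/
@[simp]
lemma StdSimplex.segm_one {q : ℕ} (a b : StdSimplex q) : StdSimplex.segm 1 a b = b := by
  apply Subtype.ext; funext i
  change (1 - ((1 : I) : ℝ)) * (a : Fin (q + 1) → ℝ) i + ((1 : I) : ℝ) * (b : Fin (q + 1) → ℝ) i =
    (b : Fin (q + 1) → ℝ) i
  simp

/-- The combination of a point with itself is the point. [folklore] -/
@[simp]
lemma StdSimplex.segm_self {q : ℕ} (s : I) (a : StdSimplex q) : StdSimplex.segm s a a = a := by
  apply Subtype.ext; funext i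
  change (1 - (s : ℝ)) * (a : Fin (q + 1) → ℝ) i + (s : ℝ) * (a : Fin (q + 1) → ℝ) i = (a : Fin (q + 1) → ℝ) i
  ring

variable {τ : C(StdSimplex (n + 1), X)}

/-- **On the horn `Λ_last`, `τ` agrees with the gluing of its faces** (a point of the horn is
`δᵢ` of its `i`-th face retraction). [folklore] -/
lemma apply_eq_hornGlue_of_mem_stdHorn (hτ : KillsTwoZero x₀ τ) {y : StdSimplex (n + 1)}
    (hy : y ∈ stdHorn (Fin.last (n + 1))) :
    τ y = hornGlue (Fin.last (n + 1)) (fun i => τ.comp (stdFace i)) y := by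
  obtain ⟨i, hij, hi⟩ := hy
  rw [hornGlue_eq_of_apply_eq_zero (hτ.faces_boundary _) hij hi, ContinuousMap.comp_apply]
  obtain ⟨w, rfl⟩ := exists_stdFace_eq i y hi
  rw [faceRetr_stdFace]

/-- **Reduction to the free face.** For `τ : Δⁿ⁺¹ → X` sending every point with two vanishing
coordinates to `x₀`, the last face `τ ∘ δ_last` is homotopic rel `∂Δⁿ` to the free face of the
horn filled with the other faces: along `s ↦ τ((1-s)·δz + s·r(δz))` (`r` the retraction onto the
horn, `Δⁿ⁺¹` convex), ending at `τ ∘ r ∘ δ = hornGlue(τ∘δ·) ∘ r ∘ δ` since `τ` is the gluing of its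
faces on the horn; boundary points of `Δⁿ` go into the horn, where `r` is the identity. [folklore] -/
theorem homotopicRel_comp_stdFace_last_hornFace (hτ : KillsTwoZero x₀ τ) :
    (τ.comp (stdFace (Fin.last (n + 1)))).HomotopicRel
      (hornFace (fun i => τ.comp (stdFace i)) (hτ.faces_boundary _)) (stdBoundary n) := by
  let F : I × StdSimplex n → X := fun p =>
    τ (StdSimplex.segm p.1 (stdFace (Fin.last (n + 1)) p.2)
      (hornRetr (Fin.last (n + 1)) (stdFace (Fin.last (n + 1)) p.2)))
  have hF : Continuous F := τ.continuous.comp (StdSimplex.continuous_segm.comp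
    (continuous_fst.prodMk (((stdFace _).continuous.comp continuous_snd).prodMk
      ((hornRetr _).continuous.comp ((stdFace _).continuous.comp continuous_snd)))))
  refine ⟨{ toFun := F
            continuous_toFun := hF
            map_zero_left := fun z => by simp [F]
            map_one_left := fun z => ?_
            prop' := fun s z hz => ?_ }⟩
  · simp only [F, StdSimplex.segm_one]
    rw [hornFace_apply, apply_eq_hornGlue_of_mem_stdHorn hτ (hornRetr_mem_stdHorn _ _)]
  · -- boundary points: `δ z` lies in the horn and is fixed by the retraction
    change F (s, z) = τ (stdFace (Fin.last (n + 1)) z)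
    have hmem : stdFace (Fin.last (n + 1)) z ∈ stdHorn (Fin.last (n + 1)) := by
      obtain ⟨j, hj⟩ := hz
      refine ⟨j.castSucc, (Fin.castSucc_lt_last j).ne, ?_⟩
      rw [← Fin.succAbove_last_apply, stdFace_apply_succAbove]
      exact hj
    simp only [F, hornRetr_eq_self hmem, StdSimplex.segm_self]

/-- **The last face and the free face have the same class** in `πₙ(X, x₀)`. [folklore] -/
theorem simplexClass_comp_stdFace_last (hτ : KillsTwoZero x₀ τ) :
    simplexClass (τ.comp (stdFace (Fin.last (n + 1)))) (hτ.comp_stdFace _) =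
      simplexClass (x₀ := x₀) (hornFace (fun i => τ.comp (stdFace i)) (hτ.faces_boundary _))
        (fun _ hz => hornFace_apply_of_mem_stdBoundary _ _ hz) :=
  simplexClass_eq_of_homotopicRel (homotopicRel_comp_stdFace_last_hornFace hτ) _ _

end Reduction

/-! ### The regions and charts of the free face -/

section Regions

/-- The minimum of the barycentric coordinates of a point of `Δⁿ`. [folklore] -/
def zmin (z : StdSimplex n) : ℝ := Finset.univ.inf' Finset.univ_nonempty fun l => (z : Fin (n + 1) → ℝ) l

/-- `zmin z ≤ zₗ`. [folklore] -/
lemma zmin_le (z : StdSimplex n) (l : Fin (n + 1)) : zmin z ≤ (z : Fin (n + 1) → ℝ) l :=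
  Finset.inf'_le _ (Finset.mem_univ l)

/-- `0 ≤ zmin z`. [folklore] -/
lemma zmin_nonneg (z : StdSimplex n) : 0 ≤ zmin z := Finset.le_inf' _ _ fun l _ => z.2.1 l

/-- The minimum is attained. [folklore] -/
lemma exists_apply_eq_zmin (z : StdSimplex n) : ∃ i, (z : Fin (n + 1) → ℝ) i = zmin z := by
  obtain ⟨i, _, h⟩ := Finset.exists_mem_eq_inf' Finset.univ_nonempty (fun l => (z : Fin (n + 1) → ℝ) l)
  exact ⟨i, h.symm⟩

/-- `zmin` is continuous. [folklore] -/
lemma continuous_zmin : Continuous (zmin (n := n)) :=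
  Continuous.finset_inf'_apply _ fun i _ => (continuous_apply i).comp continuous_subtype_val

/-- The horn minimum of the last coface of `z` is the minimum of the coordinates of `z`. [folklore] -/
lemma hornMin_stdFace_last (z : StdSimplex n) :
    hornMin (Fin.last (n + 1)) (stdFace (Fin.last (n + 1)) z) = zmin z := by
  unfold hornMin zmin
  apply le_antisymm
  · refine Finset.le_inf' _ _ fun l _ => ?_
    have h := Finset.inf'_le (fun i => (stdFace (Fin.last (n + 1)) z : Fin (n + 2) → ℝ) i)
      (Finset.mem_erase.2 ⟨(Fin.castSucc_lt_last l).ne, Finset.mem_univ l.castSucc⟩)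
    have e : (stdFace (Fin.last (n + 1)) z : Fin (n + 2) → ℝ) l.castSucc = (z : Fin (n + 1) → ℝ) l := by
      rw [← Fin.succAbove_last_apply, stdFace_apply_succAbove]
    exact h.trans e.le
  · refine Finset.le_inf' _ _ fun i hi => ?_
    obtain ⟨l, rfl⟩ := Fin.exists_succAbove_eq (Finset.mem_erase.1 hi).1
    rw [stdFace_apply_succAbove]
    exact Finset.inf'_le _ (Finset.mem_univ l)

/-- **The region where the `i`-th coordinate is minimal** (the preimage of the `i`-th facet of
the horn under the retraction of the free face). [folklore] -/
def minCone (i : Fin (n + 1)) : Set (StdSimplex n) := {z | ∀ l, (z : Fin (n + 1) → ℝ) i ≤ (z : Fin (n + 1) → ℝ) l}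

/-- Membership in the region. [folklore] -/
lemma mem_minCone_iff (i : Fin (n + 1)) (z : StdSimplex n) :
    z ∈ minCone i ↔ ∀ l, (z : Fin (n + 1) → ℝ) i ≤ (z : Fin (n + 1) → ℝ) l := Iff.rfl

/-- On the `i`-th region the minimum is the `i`-th coordinate. [folklore] -/
lemma zmin_eq_of_mem_minCone {i : Fin (n + 1)} {z : StdSimplex n} (hz : z ∈ minCone i) :
    zmin z = (z : Fin (n + 1) → ℝ) i :=
  le_antisymm (zmin_le z i) (Finset.le_inf' _ _ fun l _ => hz l)

/-- Every point lies in some region. [folklore] -/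
lemma exists_mem_minCone (z : StdSimplex n) : ∃ i, z ∈ minCone i := by
  obtain ⟨i, hi⟩ := exists_apply_eq_zmin z
  exact ⟨i, fun l => hi ▸ zmin_le z l⟩

/-- The regions cover `Δⁿ`. [folklore] -/
lemma iUnion_minCone : (⋃ i, minCone (n := n) i) = univ :=
  eq_univ_of_forall fun z => mem_iUnion.2 (exists_mem_minCone z)

/-- The regions are closed. [folklore] -/
lemma isClosed_minCone (i : Fin (n + 1)) : IsClosed (minCone (n := n) i) := by
  have h : minCone (n := n) i = ⋂ l, {z : StdSimplex n | (z : Fin (n + 1) → ℝ) i ≤ (z : Fin (n + 1) → ℝ) l} := by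
    ext z; simp [minCone]
  rw [h]
  exact isClosed_iInter fun l => isClosed_le ((continuous_apply i).comp continuous_subtype_val)
    ((continuous_apply l).comp continuous_subtype_val)

/-- **The retraction of the free face** `ρ = r ∘ δ_last : Δⁿ → Λ ⊆ Δⁿ⁺¹`. [folklore] -/
def hornRho : C(StdSimplex n, StdSimplex (n + 1)) :=
  (hornRetr (Fin.last (n + 1))).comp (stdFace (Fin.last (n + 1)))

/-- Coordinates of `ρ z` below the last: `zₗ - min z`. [folklore] -/
lemma hornRho_apply_castSucc (z : StdSimplex n) (l : Fin (n + 1)) :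
    (hornRho z : Fin (n + 2) → ℝ) l.castSucc = (z : Fin (n + 1) → ℝ) l - zmin z := by
  change (hornRetr (Fin.last (n + 1)) (stdFace (Fin.last (n + 1)) z) : Fin (n + 2) → ℝ) l.castSucc = _
  rw [hornRetr_apply_of_ne (Fin.castSucc_lt_last l).ne, hornMin_stdFace_last,
    ← Fin.succAbove_last_apply, stdFace_apply_succAbove]

/-- The last coordinate of `ρ z`: `(n + 1) min z`. [folklore] -/
lemma hornRho_apply_last (z : StdSimplex n) :
    (hornRho z : Fin (n + 2) → ℝ) (Fin.last (n + 1)) = ((n : ℝ) + 1) * zmin z := by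
  change (hornRetr (Fin.last (n + 1)) (stdFace (Fin.last (n + 1)) z) : Fin (n + 2) → ℝ) (Fin.last (n + 1)) = _
  rw [hornRetr_apply_self, hornMin_stdFace_last, stdFace_apply_self, zero_add]

/-- On the `i`-th region, the `i`-th coordinate of `ρ z` vanishes (`ρ z` lies on the `i`-th facet
of the horn). [folklore] -/
lemma hornRho_apply_castSucc_eq_zero {i : Fin (n + 1)} {z : StdSimplex n} (hz : z ∈ minCone i) :
    (hornRho z : Fin (n + 2) → ℝ) i.castSucc = 0 := by
  rw [hornRho_apply_castSucc, zmin_eq_of_mem_minCone hz, sub_self]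

/-- **The chart of the `i`-th region**: `φᵢ = faceRetr i ∘ ρ : Δⁿ → Δⁿ` (meaningful on
`minCone i`, where it is affine: `z ↦ ((zₗ - zᵢ)_{l ≠ i}, (n+1) zᵢ)`). [folklore] -/
def hornChart (i : Fin (n + 1)) : C(StdSimplex n, StdSimplex n) := (faceRetr i.castSucc).comp hornRho

/-- **On the `i`-th region the free face is the `i`-th prescribed face read through the chart**:
`M(g) z = gᵢ (φᵢ z)` for `z ∈ minCone i`. [folklore] -/
theorem hornFace_apply_of_mem_minCone (g : Fin (n + 2) → C(StdSimplex n, X))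
    (hg : ∀ l, l ≠ Fin.last (n + 1) → ∀ z ∈ stdBoundary n, g l z = x₀) {i : Fin (n + 1)} {z : StdSimplex n}
    (hz : z ∈ minCone i) : hornFace g hg z = g i.castSucc (hornChart i z) := by
  rw [hornFace_apply]
  exact hornGlue_eq_of_apply_eq_zero hg (Fin.castSucc_lt_last i).ne (hornRho_apply_castSucc_eq_zero hz)

/-- The coordinates of the chart on its region: for `l : Fin (n + 1)`, the `l`-th coordinate of
`φᵢ z` is the `(i.castSucc).succAbove l`-th coordinate of `ρ z` (the correction term of `faceRetr`
vanishes since `(ρ z)ᵢ = 0`). [folklore] -/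
lemma hornChart_apply_of_mem_minCone {i : Fin (n + 1)} {z : StdSimplex n} (hz : z ∈ minCone i)
    (l : Fin (n + 1)) :
    (hornChart i z : Fin (n + 1) → ℝ) l = (hornRho z : Fin (n + 2) → ℝ) (i.castSucc.succAbove l) := by
  change (hornRho z : Fin (n + 2) → ℝ) (i.castSucc.succAbove l) +
    (if l = 0 then (hornRho z : Fin (n + 2) → ℝ) i.castSucc else 0) = _
  rw [hornRho_apply_castSucc_eq_zero hz, ite_self, add_zero]

/-- The chart of the LAST region in coordinates: `φₙ z = (z₀ - zₙ, …, zₙ₋₁ - zₙ, (n+1) zₙ)` on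
`minCone (last n)` — no reordering of coordinates. [folklore] -/
lemma hornChart_last_apply_castSucc {z : StdSimplex n} (hz : z ∈ minCone (Fin.last n)) (l : Fin n) :
    (hornChart (Fin.last n) z : Fin (n + 1) → ℝ) l.castSucc =
      (z : Fin (n + 1) → ℝ) l.castSucc - (z : Fin (n + 1) → ℝ) (Fin.last n) := by
  rw [hornChart_apply_of_mem_minCone hz, show (Fin.last n).castSucc.succAbove l.castSucc = l.castSucc.castSucc
    from Fin.succAbove_castSucc_of_lt _ _ (Fin.castSucc_lt_last l), hornRho_apply_castSucc,
    zmin_eq_of_mem_minCone hz]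

/-- The last coordinate of the chart of the last region: `(n + 1) zₙ`. [folklore] -/
lemma hornChart_last_apply_last {z : StdSimplex n} (hz : z ∈ minCone (Fin.last n)) :
    (hornChart (Fin.last n) z : Fin (n + 1) → ℝ) (Fin.last n) =
      ((n : ℝ) + 1) * (z : Fin (n + 1) → ℝ) (Fin.last n) := by
  rw [hornChart_apply_of_mem_minCone hz, Fin.succAbove_castSucc_self,
    show (Fin.last n).succ = Fin.last (n + 1) from Fin.succ_last n, hornRho_apply_last,
    zmin_eq_of_mem_minCone hz]

end Regions

end Literature.AlgebraicTopology.SingularHomology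

end
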